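import Literature.NumberTheory.DiophantineGeometry.GenEllDeFibresFamily
import Literature.NumberTheory.DiophantineGeometry.PlaneCurveResultantLocus

/-!
# [GenEll] Thm 2.1 for `ℙ¹` (route piece W5-F-d): `X_T = x(t_c⁻¹(B))` is the root set of ONE
# polynomial over the ground field — the resultant

Support file for the cell's number-field-only architecture of `GenEllTwo` (stmt-ABC-19679;
S. Mochizuki, *Arithmetic elliptic curves in general position*, Math. J. Okayama Univ. **52**
(2010), Thm. 2.1 (ii) ⇒ (i), proof pp. 12–13; S6's OWNER RULING #6 + AMENDMENT: per-configuration
protection with the family `t_c = 1/r + c·r^{k+1}/s` on `D_e : r^e = x(1−x)`, `e = 2k+1`; the spine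
`vojtaIneq_univ_of_persistent` (w5-d081, p414390) consumes the bad set `X_T` as `g.aroots ℂ`,
`g.aroots (PadicAlgCl 2)` and the protection as `IsCoprime g q` for ONE `g ∈ ℚ[X]`).

Here the finite set `B ⊂ ℙ¹ ∖ {∞}` of bad `t_c`-values is given by a POLYNOMIAL `m ∈ K[X]`
(`B = roots of m`; no splitting field needed), and we construct `g`:
* `homFibrePolyC k c m ∈ K[x][r]` — the bihomogenised numerator
  `G_m(x,r) := Σ_{i ≤ n} m_i · T_c^i · (r s)^{n−i}`, `T_c = s + c r^{k+2}`, `s = 1 − 2x`, `n = deg m`,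
  so that on the curve, off the poles, `G_m = (r s)^n · m(t_c)` (`eval_homFibrePolyC_of_ne_zero`),
  while AT a pole `G_m = lc(m)·T_c^n ≠ 0` (`eval_homFibrePolyC_of_eq_zero`); hence
  `G_m(z) = 0 ↔ z ∉ poles ∧ m(t_c(z)) = 0` (`homFibre_iff_t`, `c ≠ 0`, `m ≠ 0`);
* `not_dvd_homFibrePolyC` (specialise `x = 0`, then `r = 0`: value `lc m ≠ 0`), so
  `g := Res_r(curvePoly, G_m) ∈ K[x]` is NONZERO (`resultant_homFibrePolyC_ne_zero`);
* `rootSet_resultant_homFibrePolyC` — for every ALGEBRAICALLY CLOSED `Ω ⊇ K`: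
  `g.rootSet Ω = ↑(De.XphiC k c (m.aroots Ω).toFinset)` = `{x ∈ Ω : ∃ r, r^e = x(1−x), r s ≠ 0,
  m(t_c(x,r)) = 0}` — ONE `g` for `Ω = ℂ` and `Ω = ℚ̄_2`;
* `aeval_resultant_ne_zero_of_cusp` — `g(0) ≠ 0`, `g(1) ≠ 0` in `Ω` (no cusps in `X_T`).
Classical elimination; nothing here bears on [IUTchIII].
-/

namespace Literature.NumberTheory.DiophantineGeometry.GenEll.De

open Polynomial

universe u v

section Defs

variable {K : Type u} [Field K] {F : Type v} [Field F] [Algebra K F]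

/-- `T_c = (1 − 2x) + c·r^{k+2}` as a polynomial in `r` over `K[x]`.
[cite: MochizukiGenEll2010, Thm 2.1 proof p.12, P1ROUTE §2 (B) / ruling #6 (family t_c)] -/
noncomputable def TpolyC (k : ℕ) (c : K) : K[X][X] := C (1 - 2 * X) + C (C c) * X ^ (k + 2)

/-- `r·s = r·(1 − 2x)` as a polynomial in `r` over `K[x]`.
[cite: MochizukiGenEll2010, Thm 2.1 proof p.12, P1ROUTE §2 (B) / ruling #6] -/
noncomputable def rsPoly : K[X][X] := X * C (1 - 2 * X)

/-- The bihomogenised numerator `G_m(x,r) := Σ_{i ≤ deg m} m_i · T_c^i · (r s)^{deg m − i}` of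
`m(t_c)`, `t_c = T_c/(r s)`, for a polynomial `m ∈ K[X]` describing the bad value set `B = roots(m)`.
[cite: MochizukiGenEll2010, Thm 2.1 proof p.12 (E := supp φ⁻¹), P1ROUTE §4 / ruling #6] -/
noncomputable def homFibrePolyC (k : ℕ) (c : K) (m : K[X]) : K[X][X] :=
  ∑ i ∈ Finset.range (m.natDegree + 1),
    C (C (m.coeff i)) * TpolyC k c ^ i * rsPoly ^ (m.natDegree - i)

/-- Evaluation of `T_c` at an `F`-point. [cite: MochizukiGenEll2010, Thm 2.1 proof p.12, ruling #6] -/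
theorem eval_TpolyC (k : ℕ) (c : K) (x r : F) :
    ((TpolyC k c).map (aeval x).toRingHom).eval r = (1 - 2 * x) + algebraMap K F c * r ^ (k + 2) := by
  simp [TpolyC, Polynomial.map_mul, Polynomial.map_pow, map_ofNat]

/-- Evaluation of `r s` at an `F`-point. [cite: MochizukiGenEll2010, Thm 2.1 proof p.12, ruling #6] -/
theorem eval_rsPoly (x r : F) :
    ((rsPoly (K := K)).map (aeval x).toRingHom).eval r = r * (1 - 2 * x) := by
  simp [rsPoly, Polynomial.map_mul, map_ofNat]

/-- Evaluation of `G_m` at an `F`-point: `Σ_i m_i · T_c^i · (r s)^{n−i}`.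
[cite: MochizukiGenEll2010, Thm 2.1 proof p.12, ruling #6] -/
theorem eval_homFibrePolyC (k : ℕ) (c : K) (m : K[X]) (x r : F) :
    ((homFibrePolyC k c m).map (aeval x).toRingHom).eval r =
      ∑ i ∈ Finset.range (m.natDegree + 1), algebraMap K F (m.coeff i) *
        ((1 - 2 * x) + algebraMap K F c * r ^ (k + 2)) ^ i * (r * (1 - 2 * x)) ^ (m.natDegree - i) := by
  simp only [homFibrePolyC, Polynomial.map_sum, Polynomial.map_mul, Polynomial.map_pow, eval_finsetSum,
    eval_mul, eval_pow, eval_TpolyC, eval_rsPoly, map_C, eval_C]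
  refine Finset.sum_congr rfl fun i _ => ?_
  congr 1
  congr 1
  simp [aeval_C]

/-- **Off the poles `G_m = (r s)^n · m(t_c)`**: for `r s ≠ 0`,
`G_m(x,r) = (r s)^{deg m} · m(T_c/(r s))`. [cite: MochizukiGenEll2010, Thm 2.1 proof p.12, ruling #6] -/
theorem eval_homFibrePolyC_of_ne_zero (k : ℕ) (c : K) (m : K[X]) {x r : F}
    (hrs : r * (1 - 2 * x) ≠ 0) :
    ((homFibrePolyC k c m).map (aeval x).toRingHom).eval r =
      (r * (1 - 2 * x)) ^ m.natDegree *
        aeval (((1 - 2 * x) + algebraMap K F c * r ^ (k + 2)) / (r * (1 - 2 * x))) m := by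
  rw [eval_homFibrePolyC, aeval_eq_sum_range, Finset.mul_sum]
  refine Finset.sum_congr rfl fun i hi => ?_
  have hi' : i ≤ m.natDegree := Nat.lt_succ_iff.mp (Finset.mem_range.mp hi)
  rw [Algebra.smul_def, div_pow]
  obtain ⟨j, hj⟩ := Nat.exists_eq_add_of_le hi'
  rw [hj, Nat.add_sub_cancel_left]
  have hpow : (r * (1 - 2 * x)) ^ i ≠ 0 := pow_ne_zero _ hrs
  rw [show (r * (1 - 2 * x)) ^ (i + j) * (algebraMap K F (m.coeff i) *
        (((1 - 2 * x) + algebraMap K F c * r ^ (k + 2)) ^ i / (r * (1 - 2 * x)) ^ i)) =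
      algebraMap K F (m.coeff i) * ((1 - 2 * x) + algebraMap K F c * r ^ (k + 2)) ^ i *
        (r * (1 - 2 * x)) ^ j * ((r * (1 - 2 * x)) ^ i / (r * (1 - 2 * x)) ^ i) by ring,
    div_self hpow, mul_one]

/-- **At a pole `G_m = lc(m) · T_c^n`**: for `r s = 0` only the top term survives.
[cite: MochizukiGenEll2010, Thm 2.1 proof p.12, ruling #6] -/
theorem eval_homFibrePolyC_of_eq_zero (k : ℕ) (c : K) (m : K[X]) {x r : F}
    (hrs : r * (1 - 2 * x) = 0) :
    ((homFibrePolyC k c m).map (aeval x).toRingHom).eval r =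
      algebraMap K F m.leadingCoeff * ((1 - 2 * x) + algebraMap K F c * r ^ (k + 2)) ^ m.natDegree := by
  rw [eval_homFibrePolyC, Finset.sum_eq_single m.natDegree]
  · rw [Nat.sub_self, pow_zero, mul_one, Polynomial.leadingCoeff]
  · intro i hi hne
    have hi' : i < m.natDegree := lt_of_le_of_ne (Nat.lt_succ_iff.mp (Finset.mem_range.mp hi)) hne
    rw [hrs, zero_pow (Nat.sub_ne_zero_of_lt hi'), mul_zero]
  · intro h
    exact absurd (Finset.self_mem_range_succ m.natDegree) h

end Defs

/-! ### `G_m` cuts out exactly `t_c⁻¹(roots m)`; `curvePoly ∤ G_m` -/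

section Fibre

variable {K : Type u} [Field K] {F : Type v} [Field F] [Algebra K F]

/-- **`G_m(z) = 0 ↔ z` is not a pole of `t_c` and `m(t_c(z)) = 0`** (on the curve, `c ≠ 0`,
`m ≠ 0`): at a pole `T_c ≠ 0` (`r = 0 ⇒ T_c = s = ±1`; `s = 0 ⇒ T_c = c r^{k+2}`, `r ≠ 0`).
[cite: MochizukiGenEll2010, Thm 2.1 proof p.12, P1ROUTE §2 (B) (poles of t) / ruling #6] -/
theorem homFibre_iff_t (k : ℕ) {c : K} (hc : c ≠ 0) {m : K[X]} (hm : m ≠ 0) (z : F × F)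
    (hz : z.2 ^ (2 * k + 1) = z.1 * (1 - z.1)) :
    ((homFibrePolyC k c m).map (aeval z.1).toRingHom).eval z.2 = 0 ↔
      z.2 ≠ 0 ∧ 1 - 2 * z.1 ≠ 0 ∧
        aeval (((1 - 2 * z.1) + algebraMap K F c * z.2 ^ (k + 2)) / (z.2 * (1 - 2 * z.1))) m = 0 := by
  have hcF : algebraMap K F c ≠ 0 := (map_ne_zero_iff _ (algebraMap K F).injective).mpr hc
  by_cases hrs : z.2 * (1 - 2 * z.1) = 0
  · -- at a pole: the value is `lc(m) · T^n ≠ 0`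
    rw [eval_homFibrePolyC_of_eq_zero k c m hrs]
    have hT : (1 - 2 * z.1) + algebraMap K F c * z.2 ^ (k + 2) ≠ 0 := by
      rcases mul_eq_zero.mp hrs with hr | hs
      · have hz' : z.1 * (1 - z.1) = 0 := by
          rw [← hz, hr]; exact zero_pow (by omega : 2 * k + 1 ≠ 0)
        rw [hr, zero_pow (by omega : k + 2 ≠ 0), mul_zero, add_zero]
        rcases mul_eq_zero.mp hz' with hx | hx
        · rw [hx]; norm_num
        · rw [sub_eq_zero] at hx; rw [← hx]; norm_num
      · rw [hs, zero_add]
        refine mul_ne_zero hcF (pow_ne_zero _ fun hr => ?_)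
        have hz' : z.1 * (1 - z.1) = 0 := by
          rw [← hz, hr]; exact zero_pow (by omega : 2 * k + 1 ≠ 0)
        rcases mul_eq_zero.mp hz' with hx | hx
        · rw [hx] at hs; norm_num at hs
        · rw [sub_eq_zero] at hx; rw [← hx] at hs; norm_num at hs
    have hlc : algebraMap K F m.leadingCoeff ≠ 0 :=
      (map_ne_zero_iff _ (algebraMap K F).injective).mpr (leadingCoeff_ne_zero.mpr hm)
    constructor
    · intro h; exact absurd h (mul_ne_zero hlc (pow_ne_zero _ hT))
    · rintro ⟨hr, hs, -⟩; exact absurd hrs (mul_ne_zero hr hs)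
  · rw [eval_homFibrePolyC_of_ne_zero k c m hrs]
    have hrs' := mul_ne_zero_iff.mp hrs
    constructor
    · intro h
      exact ⟨hrs'.1, hrs'.2, (mul_eq_zero.mp h).resolve_left (pow_ne_zero _ hrs)⟩
    · rintro ⟨-, -, h⟩; rw [h, mul_zero]

/-- `curvePoly ∤ G_m` for `m ≠ 0`: specialising `x = 0` gives `G_m(0, r) = Σ m_i (1 + c r^{k+2})^i r^{n−i}`,
whose value at `r = 0` is `lc m ≠ 0`, whereas `curvePoly(0, r) = r^{2k+1}`.
[cite: MochizukiGenEll2010, Thm 2.1 proof p.12, ruling #6] -/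
theorem not_dvd_homFibrePolyC (k : ℕ) (c : K) {m : K[X]} (hm : m ≠ 0) :
    ¬ curvePoly k ∣ homFibrePolyC k c m := by
  intro h
  -- evaluate at the point `(0, 0)` of the curve: `curvePoly (0,0) = 0` but `G_m(0,0) = lc m`
  have h0 : ((curvePoly (K := K) k).map (aeval (0 : K)).toRingHom).eval 0 = 0 := by
    rw [eval_curvePoly]; simp
  have hdvd : (curvePoly (K := K) k).map (aeval (0 : K)).toRingHom ∣
      (homFibrePolyC k c m).map (aeval (0 : K)).toRingHom := Polynomial.map_dvd _ h
  have hG0 : ((homFibrePolyC k c m).map (aeval (0 : K)).toRingHom).eval 0 = 0 :=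
    eval_eq_zero_of_dvd_of_eval_eq_zero hdvd h0
  rw [eval_homFibrePolyC_of_eq_zero k c m (by simp)] at hG0
  have hlc : m.leadingCoeff = 0 := by
    simpa [zero_pow (show k + 2 ≠ 0 by omega)] using hG0
  exact leadingCoeff_ne_zero.mpr hm hlc

/-- Coprimality of `curvePoly` and `G_m` in `K(x)[Y]` (Gauss). [cite: MochizukiGenEll2010, Thm 2.1 proof p.12, ruling #6] -/
theorem isCoprime_curvePoly_homFibrePolyC (k : ℕ) (c : K) {m : K[X]} (hm : m ≠ 0) :
    IsCoprime ((curvePoly k).map (algebraMap K[X] (RatFunc K)))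
      ((homFibrePolyC k c m).map (algebraMap K[X] (RatFunc K))) :=
  PlaneCurve.isCoprime_map_of_irreducible _ _ (monic_curvePoly k) (irreducible_curvePoly k)
    (not_dvd_homFibrePolyC k c hm)

/-- **`g := Res_r(curvePoly, G_m) ≠ 0`.** [cite: BombieriGubler2006, B.1.8 (resultant of coprime polynomials, monic case)] -/
theorem resultant_homFibrePolyC_ne_zero (k : ℕ) (c : K) {m : K[X]} (hm : m ≠ 0) :
    resultant (curvePoly k) (homFibrePolyC k c m) ≠ 0 :=
  PlaneCurve.resultant_ne_zero_of_isCoprime_map _ _ (monic_curvePoly k)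
    (isCoprime_curvePoly_homFibrePolyC k c hm)

end Fibre

/-! ### The root set of the resultant is `X_T`, over every algebraically closed field -/

section RootSet

variable {K : Type u} [Field K] {Ω : Type v} [Field Ω] [Algebra K Ω] [IsAlgClosed Ω]

/-- **`X_T` is the root set of the resultant**: for `c ≠ 0`, `m ≠ 0` and every algebraically closed
`Ω ⊇ K`, the root set in `Ω` of `g := Res_r(curvePoly, G_m) ∈ K[x]` is the set of `x ∈ Ω` carrying
an affine point `(x, r)` of `D_e`, not a pole of `t_c`, with `m(t_c(x,r)) = 0`.
[cite: MochizukiGenEll2010, Thm 2.1 proof p.12 (E ⊂ Y(ℚ̄), its image in X), P1ROUTE §4 / ruling #6] -/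
theorem rootSet_resultant_homFibrePolyC (k : ℕ) {c : K} (hc : c ≠ 0) {m : K[X]} (hm : m ≠ 0) :
    (resultant (curvePoly k) (homFibrePolyC k c m)).rootSet Ω =
      {x : Ω | ∃ r : Ω, r ^ (2 * k + 1) = x * (1 - x) ∧ r ≠ 0 ∧ 1 - 2 * x ≠ 0 ∧
        aeval (((1 - 2 * x) + algebraMap K Ω c * r ^ (k + 2)) / (r * (1 - 2 * x))) m = 0} := by
  rw [PlaneCurve.rootSet_resultant_eq _ _ (monic_curvePoly k) (by rw [natDegree_curvePoly]; omega)
    (isCoprime_curvePoly_homFibrePolyC k c hm)]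
  ext x
  simp only [Set.mem_image, Set.mem_setOf_eq, Prod.exists, exists_and_right, exists_eq_right]
  constructor
  · rintro ⟨r, hcurve, hG⟩
    rw [eval_curvePoly, sub_eq_zero] at hcurve
    obtain ⟨hr, hs, ht⟩ := (homFibre_iff_t k hc hm (x, r) hcurve).mp hG
    exact ⟨r, hcurve, hr, hs, ht⟩
  · rintro ⟨r, hcurve, hr, hs, ht⟩
    refine ⟨r, ?_, (homFibre_iff_t k hc hm (x, r) hcurve).mpr ⟨hr, hs, ht⟩⟩
    rw [eval_curvePoly, sub_eq_zero]; exact hcurve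

variable [DecidableEq Ω]

/-- **`X_T` as a `Finset`**: the root set of `g` in `Ω` is the coercion of
`De.XphiC k c (m.aroots Ω).toFinset` (the `t_c`-fibre `Finset` of `GenEllDeFibresFamily` with
`B := roots of m in Ω`).  So ONE `g ∈ K[X]` satisfies `↑(g.aroots ℂ).toFinset = X_T(ℂ)` and likewise in
`ℚ̄_2` — the currency of the spine `vojtaIneq_univ_of_persistent`.
[cite: MochizukiGenEll2010, Thm 2.1 proof p.12, P1ROUTE §4 / ruling #6] -/
theorem rootSet_resultant_eq_XphiC (k : ℕ) {c : K} (hc : c ≠ 0) {m : K[X]} (hm : m ≠ 0) :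
    (resultant (curvePoly k) (homFibrePolyC k c m)).rootSet Ω =
      ↑(XphiC k (algebraMap K Ω c) ((m.aroots Ω).toFinset)) := by
  classical
  have hcΩ : algebraMap K Ω c ≠ 0 := (map_ne_zero_iff _ (algebraMap K Ω).injective).mpr hc
  rw [rootSet_resultant_homFibrePolyC k hc hm]
  ext x
  simp only [Set.mem_setOf_eq, Finset.mem_coe, mem_XphiC, mem_EphiC_iff_t hcΩ,
    Multiset.mem_toFinset, mem_aroots]
  constructor
  · rintro ⟨r, hcurve, hr, hs, ht⟩
    exact ⟨r, hcurve, hr, hs, hm, ht⟩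
  · rintro ⟨r, hcurve, hr, hs, -, ht⟩
    exact ⟨r, hcurve, hr, hs, ht⟩

/-- **No cusps**: `g(0) ≠ 0` and `g(1) ≠ 0` in `Ω` (`0, 1 ∉ X_T`).
[cite: MochizukiGenEll2010, Thm 2.1 proof p.12 (φ noncritical at the cusps), P1ROUTE §4 / ruling #6] -/
theorem aeval_resultant_ne_zero_of_cusp (k : ℕ) {c : K} (hc : c ≠ 0) {m : K[X]} (hm : m ≠ 0) :
    aeval (0 : Ω) (resultant (curvePoly k) (homFibrePolyC k c m)) ≠ 0 ∧
      aeval (1 : Ω) (resultant (curvePoly k) (homFibrePolyC k c m)) ≠ 0 := by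
  classical
  have hres := resultant_homFibrePolyC_ne_zero k c hm
  have key : ∀ x : Ω, aeval x (resultant (curvePoly k) (homFibrePolyC k c m)) = 0 →
      x ∈ XphiC k (algebraMap K Ω c) ((m.aroots Ω).toFinset) := by
    intro x hx
    have : x ∈ (resultant (curvePoly k) (homFibrePolyC k c m)).rootSet Ω :=
      Polynomial.mem_rootSet.mpr ⟨hres, hx⟩
    rwa [rootSet_resultant_eq_XphiC k hc hm] at this
  exact ⟨fun h => zero_not_mem_XphiC k _ _ (key 0 h), fun h => one_not_mem_XphiC k _ _ (key 1 h)⟩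

end RootSet

end Literature.NumberTheory.DiophantineGeometry.GenEll.De
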